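import Literature.Analysis.FluidPDE.LerayEnstrophyAPrioriForced
import Literature.Analysis.FluidPDE.NSSerrinUniquenessForced
import Literature.Analysis.FluidPDE.TaoForcedFiniteEnergyLerayHopfL2
import Literature.Analysis.FluidPDE.TaoH1AlmostRegularAssembly
import Literature.Analysis.FluidPDE.ClayForceTimeShift
import Literature.Analysis.FluidPDE.IsometryInvariance
import HarnessLib

/-!
# Classical representatives of a forced Leray–Hopf solution from a restart, by forced weak–strong
# uniqueness (Tao 2013, proof of Thm. 5.4 (ii)–(iii), `f ≠ 0`)

Analysis/FluidPDE proof file (cell `pub/ns-blowup`, seat `ns-blowup-lean` g8; piece of the assembly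
P6 of the chain «`tao2011_forced_H1_local_almost_regular` (p428734) ⇐ F2», the part of the unforced
assembly `TaoH1AlmostRegularAssembly.lean` (§ *Classical representatives from a restart and
weak–strong uniqueness*) that does not depend on the forced `L²`-stability / Leray–Hopf limit /
full-slab existence files. WHAT THIS IS NOT: not a statement about Navier–Stokes blow-up —
uniqueness bookkeeping for weak solutions of the FORCED system; no definitions, no named facts.

`exists_classical_rep_of_restart_forced` — the FORCED twin of `exists_classical_rep_of_restart`: let
`v(· + s)` be Leray–Hopf on `[0, T − s)` from `v(s)` with the (restarted) force `g`, jointly smooth on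
the slab with uniform Schwartz bounds there, and let `(W, P)` be a classical solution of Tao's class on
`[0, T − s]` with the same force and `W(0) = v(s)` a.e. Then `v(t + s) = W(t)` a.e. for
`t ∈ (0, T − s]` — `W` is Leray–Hopf from `v(s)` with force `g`
(`IsClassicalNSSolutionOn.isLerayHopfOn_of_finiteEnergy_forced_L2`, Tao 2013, Lemma 8.1 WITH force)
and bounded, and forced weak–strong uniqueness in Serrin's class `L^∞L^∞` applies
(`serrinMasuda_weak_strong_uniqueness_forced`, the force entering the guarded class through the
equation itself, `force_prod_aestronglyMeasurable` / `force_prod_eLpNorm_two_lt_top`) — so that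
`w = W(· − s)`, `π = P(· − s)` is a classical representative of `v` on every `[τ, T]`, `s < τ < T`,
of Tao's class, solving the system with force `g(· − s)`, with continuous enstrophy (the forced
cubic enstrophy inequality `exists_enstrophy_cubic_ineq_forced`, lit g11's P1).
`exists_classical_rep_of_restart_clayForce` — the same for a Clay-class force `f` on `[0, ∞) × ℝ³`
restarted at `s ≥ 0` (`g = f(· + s)`; `ClayForceTimeShift`), with the representative solving the
system forced by `f` itself on `[τ, T]`.

## References

* T. Tao, *Localisation and compactness properties of the Navier–Stokes global regularity
  problem*, Anal. PDE 6 (2013) = arXiv:1108.1165, Thm. 5.4 (ii)–(iii), Prop. 5.6, Lemma 8.1 — all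
  printed WITH the forcing term. [Tao2011]
* J. C. Robinson, J. L. Rodrigo, W. Sadowski, *The three-dimensional Navier–Stokes equations*, CUP
  2016, Thm. 8.17 with Thm. 6.8 (restart and weak–strong uniqueness). [RobinsonRodrigoSadowski2016]
-/

noncomputable section

open MeasureTheory TopologicalSpace Set Function Filter Topology
open scoped InnerProductSpace RealInnerProductSpace ENNReal NNReal Interval

namespace Literature.Analysis.FluidPDE

/-- `∫⁻ ‖D⁰w‖ₑ² = ∫⁻ ‖w‖ₑ²` read as a bound: an `L^∞_t H^0_x` bound is an energy bound. [folklore] -/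
private theorem lintegral_enorm_sq_le_of_iteratedFDeriv_zero
    {w : EuclideanSpace ℝ (Fin 3) → EuclideanSpace ℝ (Fin 3)} {C : ℝ≥0∞}
    (h : ∫⁻ x, ‖iteratedFDeriv ℝ 0 w x‖ₑ ^ 2 ≤ C) : ∫⁻ x, ‖w x‖ₑ ^ 2 ≤ C := by
  refine le_trans (le_of_eq (lintegral_congr fun x => ?_)) h
  rw [← ofReal_norm, ← ofReal_norm, norm_iteratedFDeriv_zero]

/-- **Smooth representative on `[τ, T]` by restart and FORCED weak–strong uniqueness** (Tao 2013,
proof of Thm. 5.4 (ii)–(iii) via Prop. 5.6 and uniqueness, WITH force; Robinson–Rodrigo–Sadowski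
2016, Thm. 8.17 with Thm. 6.8). Let `g` be a force jointly smooth on `[0, T − s] × ℝ³` with uniform
Schwartz bounds there, let `v(· + s)` be Leray–Hopf on `[0, T − s)` from `v(s) ∈ L²` with force `g`,
and let `(W, P)` be a classical solution of Tao's class (`W, ∂ₜW, P ∈ L^∞_t H^k_x`) of the system
forced by `g` on `[0, T − s]` with `W(0) = v(s)` a.e. Then `v(t + s) = W(t)` a.e. for
`t ∈ (0, T − s]` (`W` is a bounded Leray–Hopf solution from `v(s)` with force `g`; forced
weak–strong uniqueness in Serrin's class `L^∞L^∞`), so that `w = W(· − s)`, `π = P(· − s)` is a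
classical representative of `v` on `[τ, T]`, `s < τ < T`, of Tao's class, solving the system with force
`g(· − s)`, with continuous enstrophy. [cite: Tao2011, Thm. 5.4 (ii)-(iii)] -/
theorem exists_classical_rep_of_restart_forced {ν T s τ : ℝ} (hν : 0 < ν) (hsτ : s < τ)
    (hτT : τ < T) {g : ℝ → EuclideanSpace ℝ (Fin 3) → EuclideanSpace ℝ (Fin 3)}
    (hgS : IsSmoothSpaceTimeOn (Icc 0 (T - s)) g) (hgD : HasUniformRapidDecayOn (Icc 0 (T - s)) g)
    {v : ℝ → EuclideanSpace ℝ (Fin 3) → EuclideanSpace ℝ (Fin 3)} (hvs : MemLp (v s) 2 volume)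
    (hLHs : IsLerayHopfOn (T - s) ν g (v s) (fun t => v (t + s)))
    {W : ℝ → EuclideanSpace ℝ (Fin 3) → EuclideanSpace ℝ (Fin 3)}
    {P : ℝ → EuclideanSpace ℝ (Fin 3) → ℝ}
    (hW : IsClassicalNSSolutionOn (Icc 0 (T - s)) ν g W P)
    (hW0 : W 0 =ᵐ[volume] v s) (hWB : HasBoundedSobolevNormsOn (Icc 0 (T - s)) W)
    (hWB' : HasBoundedSobolevNormsOn (Icc 0 (T - s)) (timeDerivWithin (Icc 0 (T - s)) W))
    (hPB : ∀ n : ℕ, ∃ C : ℝ≥0, ∀ t ∈ Icc 0 (T - s), ∫⁻ x, ‖iteratedFDeriv ℝ n (P t) x‖ₑ ^ 2 ≤ C) :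
    ∃ (w : ℝ → EuclideanSpace ℝ (Fin 3) → EuclideanSpace ℝ (Fin 3))
      (π : ℝ → EuclideanSpace ℝ (Fin 3) → ℝ),
      IsClassicalNSSolutionOn (Icc τ T) ν (fun t => g (t + -s)) w π ∧
      HasBoundedSobolevNormsOn (Icc τ T) w ∧
      HasBoundedSobolevNormsOn (Icc τ T) (timeDerivWithin (Icc τ T) w) ∧
      (∀ n : ℕ, ∃ C : ℝ≥0, ∀ t ∈ Icc τ T, ∫⁻ x, ‖iteratedFDeriv ℝ n (π t) x‖ₑ ^ 2 ≤ C) ∧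
      (∀ t ∈ Icc τ T, v t =ᵐ[volume] w t) ∧
      ContinuousOn (fun t => ∫⁻ x, ENNReal.ofReal (frobeniusNormSq (fderiv ℝ (w t) x)))
        (Icc τ T) := by
  have hTs : 0 < T - s := by linarith
  -- the force slices are uniformly in `L²` on the slab
  obtain ⟨Cf, hCf⟩ := hgD.exists_lintegral_iteratedFDeriv_slice_sq_le_Icc (μ := volume) hgS hTs 0
  have hCf' : ∀ t ∈ Icc 0 (T - s), ∫⁻ x, ‖g t x‖ₑ ^ 2 ≤ (Cf : ℝ≥0∞) := fun t ht =>
    lintegral_enorm_sq_le_of_iteratedFDeriv_zero (hCf t ht)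
  -- `W` has finite energy, hence is Leray–Hopf from `W 0` with force `g`, and continuous in `L²`
  obtain ⟨C₀, hC₀⟩ := hWB 0
  have hfe : ∃ A : ℝ≥0∞, A < ⊤ ∧ ∀ t ∈ Icc 0 (T - s), ∫⁻ x, ‖W t x‖ₑ ^ 2 ≤ A :=
    ⟨C₀, ENNReal.coe_lt_top, fun t ht => lintegral_enorm_sq_le_of_iteratedFDeriv_zero (hC₀ t ht)⟩
  obtain ⟨hLHW0, -⟩ :=
    hW.isLerayHopfOn_of_finiteEnergy_forced_L2 hν hTs ENNReal.coe_ne_top hCf' hfe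
  have hLHW : IsLerayHopfOn (T - s) ν g (v s) W := hLHW0.congr_datum_ae hW0.symm
  -- `W` is bounded: Serrin's class `L^∞L^∞`
  obtain ⟨B, hB⟩ := linfty_bound_of_hasBoundedSobolevNormsOn_holds
    (fun t ht => (hW.contDiff_velocity ht).of_le (by norm_cast)) hWB
  have hS : MemLqLp ∞ ∞ W (Ioo 0 (T - s)) :=
    memLqLp_top_top_of_forall_norm_le measurableSet_Ioo (le_max_right B 0)
      (fun t ht => (hW.contDiff_velocity (Ioo_subset_Icc_self ht)).continuous)
      fun t ht x => (hB t (Ioo_subset_Icc_self ht) x).trans (le_max_left _ _)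
  -- the force lies in the guarded class (read off the equation)
  have hgm := hW.force_prod_aestronglyMeasurable hTs
  have hg2 := hW.force_prod_eLpNorm_two_lt_top hTs ENNReal.coe_ne_top hCf'
  have hae : ∀ t ∈ Ioc 0 (T - s), v (t + s) =ᵐ[volume] W t :=
    serrinMasuda_weak_strong_uniqueness_forced hν hTs hgm hg2 hLHW hvs (q := ⊤) (r := ⊤) (by simp)
      (by simp) hS hLHs
  -- the translated classical solution
  have hpre : Icc τ T ⊆ (· + -s) ⁻¹' Icc 0 (T - s) := fun t ht =>
    ⟨by linarith [ht.1], by linarith [ht.2]⟩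
  have hsolw : IsClassicalNSSolutionOn (Icc τ T) ν (fun t => g (t + -s)) (fun t => W (t + -s))
      fun t => P (t + -s) :=
    (hW.comp_add_right (-s)).mono hpre (uniqueDiffOn_Icc hτT)
  have htd : ∀ t ∈ Icc τ T, timeDerivWithin (Icc τ T) (fun t => W (t + -s)) t =
      timeDerivWithin (Icc 0 (T - s)) W (t + -s) := by
    intro t ht
    funext x
    rw [(hW.comp_add_right (-s)).smooth_velocity.timeDerivWithin_eq_of_subset hpre
      (uniqueDiffOn_Icc hτT) ht x]
    exact timeDerivWithin_comp_add_right _ W (-s) t x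
  -- continuity of the enstrophy
  obtain ⟨κ, -, hcubic⟩ := exists_enstrophy_cubic_ineq_forced
  obtain ⟨hGc, -, -, -, hGeq, -⟩ := hcubic hν hTs hW hWB hWB' hPB hgS hgD
  refine ⟨fun t => W (t + -s), fun t => P (t + -s), hsolw,
    fun n => (hWB n).imp fun C hC t ht => hC (t + -s) (hpre ht),
    fun n => (hWB' n).imp fun C hC t ht => ?_,
    fun n => (hPB n).imp fun C hC t ht => hC (t + -s) (hpre ht), fun t ht => ?_, ?_⟩
  · rw [htd t ht]; exact hC (t + -s) (hpre ht)
  · have ht' : t + -s ∈ Ioc 0 (T - s) := ⟨by linarith [ht.1], by linarith [ht.2]⟩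
    have h := hae (t + -s) ht'
    rwa [neg_add_cancel_right] at h
  · have hc : ContinuousOn (fun t => ENNReal.ofReal
        (∫ x, frobeniusNormSq (fderiv ℝ (W (t + -s)) x))) (Icc τ T) :=
      ENNReal.continuous_ofReal.comp_continuousOn
        (hGc.comp (continuousOn_id.add continuousOn_const) hpre)
    exact hc.congr fun t ht => (hGeq (t + -s) (hpre ht)).symm

/-- **Clay-class corollary.** For a force `f` smooth on `[0, ∞) × ℝ³` with Fefferman's space-time
decay (5) and a restart time `s ≥ 0`, the restarted force `g = f(· + s)` is Schwartz on every slab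
(`ClayForceTimeShift`), so `exists_classical_rep_of_restart_forced` applies; the representative solves
the system forced by `f` itself on `[τ, T]`. [cite: Tao2011, Thm. 5.4 (ii)-(iii)] -/
theorem exists_classical_rep_of_restart_clayForce {ν T s τ : ℝ} (hν : 0 < ν) (hs : 0 ≤ s)
    (hsτ : s < τ) (hτT : τ < T) {f : ℝ → EuclideanSpace ℝ (Fin 3) → EuclideanSpace ℝ (Fin 3)}
    (hfs : IsSmoothOnHalfSpace f) (hfd : HasRapidSpaceTimeDecay f)
    {v : ℝ → EuclideanSpace ℝ (Fin 3) → EuclideanSpace ℝ (Fin 3)} (hvs : MemLp (v s) 2 volume)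
    (hLHs : IsLerayHopfOn (T - s) ν (fun t => f (t + s)) (v s) (fun t => v (t + s)))
    {W : ℝ → EuclideanSpace ℝ (Fin 3) → EuclideanSpace ℝ (Fin 3)}
    {P : ℝ → EuclideanSpace ℝ (Fin 3) → ℝ}
    (hW : IsClassicalNSSolutionOn (Icc 0 (T - s)) ν (fun t => f (t + s)) W P)
    (hW0 : W 0 =ᵐ[volume] v s) (hWB : HasBoundedSobolevNormsOn (Icc 0 (T - s)) W)
    (hWB' : HasBoundedSobolevNormsOn (Icc 0 (T - s)) (timeDerivWithin (Icc 0 (T - s)) W))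
    (hPB : ∀ n : ℕ, ∃ C : ℝ≥0, ∀ t ∈ Icc 0 (T - s), ∫⁻ x, ‖iteratedFDeriv ℝ n (P t) x‖ₑ ^ 2 ≤ C) :
    ∃ (w : ℝ → EuclideanSpace ℝ (Fin 3) → EuclideanSpace ℝ (Fin 3))
      (π : ℝ → EuclideanSpace ℝ (Fin 3) → ℝ),
      IsClassicalNSSolutionOn (Icc τ T) ν f w π ∧
      HasBoundedSobolevNormsOn (Icc τ T) w ∧
      HasBoundedSobolevNormsOn (Icc τ T) (timeDerivWithin (Icc τ T) w) ∧
      (∀ n : ℕ, ∃ C : ℝ≥0, ∀ t ∈ Icc τ T, ∫⁻ x, ‖iteratedFDeriv ℝ n (π t) x‖ₑ ^ 2 ≤ C) ∧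
      (∀ t ∈ Icc τ T, v t =ᵐ[volume] w t) ∧
      ContinuousOn (fun t => ∫⁻ x, ENNReal.ofReal (frobeniusNormSq (fderiv ℝ (w t) x)))
        (Icc τ T) := by
  have hTs : 0 < T - s := by linarith
  have hgS : IsSmoothSpaceTimeOn (Icc 0 (T - s)) (fun t => f (t + s)) :=
    hfs.isSmoothSpaceTimeOn_Icc_timeShift hs (T - s)
  have hgD : HasUniformRapidDecayOn (Icc 0 (T - s)) (fun t => f (t + s)) :=
    hfd.hasUniformRapidDecayOn_Icc_timeShift hfs hs hTs
  obtain ⟨w, π, hsol, h1, h2, h3, h4, h5⟩ :=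
    exists_classical_rep_of_restart_forced hν hsτ hτT hgS hgD hvs hLHs hW hW0 hWB hWB' hPB
  refine ⟨w, π, hsol.congr_force fun t _ x => ?_, h1, h2, h3, h4, h5⟩
  simp only [neg_add_cancel_right]

end Literature.Analysis.FluidPDE

end
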